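import Literature.NumberTheory.DiophantineGeometry.GenEllThm21Finite
import Literature.NumberTheory.DiophantineGeometry.GenEllDeFibresPolynomial
import Mathlib.FieldTheory.IsAlgClosed.AlgebraicClosure
import HarnessLib

/-!
# Exceptional fibres on the `λ`-line are Galois-finite ([GenEll] Ex. 1.3 (i) / Thm. 2.1 p. 12 bookkeeping)

S. Mochizuki, *Arithmetic elliptic curves in general position*, Math. J. Okayama Univ. **52** (2010)
[cite: MochizukiGenEll2010]: Ex. 1.3 (i) p. 5 ("Galois-finite": each `E^{≤d}` finite) and the proof of
Thm. 2.1, p. 12 ("[after possibly eliminating finitely many elements from `Ξ`]").  In the Lean rendering of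
the cell (`GenEllNorthcott`, `GenEllThm21Finite`) "finitely many points" of a set of PRESENTED points
`P = (F, x)` is `HasFinitelyManyPoints` (finitely many minimal polynomials over `ℚ`), and the inequality
of BD-classes `VojtaIneq S d ε` ignores such sets (`vojtaIneq_of_diff`).

This proof-only file supplies the generic producers of such exceptional sets that the `GenEllTwo`
assembly (stmt-ABC-19679) discards:

* `hasFinitelyManyPoints_aeval_eq_zero` — for `G ∈ ℚ[X]`, `G ≠ 0`, the points whose coordinate is a root
  of `G` have finitely many points (their minimal polynomials are normalised factors of `G`);
* `hasFinitelyManyPoints_x_eq_algebraMap`, `hasFinitelyManyPoints_two_mul_x_eq_one`,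
  `hasFinitelyManyPoints_x_mem_finset` — a prescribed rational coordinate (e.g. the pole fibre `x = 1/2`
  of the functions `t_c = ((1−2x) + c·r^{k+2})/(r(1−2x))` on `D_e : r^e = x(1−x)`), finitely many of them;
* `vojtaIneq_of_diff_aeval_eq_zero`, `vojtaIneq_of_diff_two_mul_x_eq_one` — the corresponding
  "discard" forms of the Vojta inequality;
* `aeval_resultant_eq_zero_of_tC_fibre`, `hasFinitelyManyPoints_tC_fibre`,
  `vojtaIneq_of_diff_tC_fibre` — the `t_c`-fibre over the root set of a nonzero `m ∈ ℚ[X]`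
  (the points `x` carrying some `r` with `r^{2k+1} = x(1−x)`, `r ≠ 0`, `1 − 2x ≠ 0`, `m(t_c(x,r)) = 0`)
  lies in the root locus of the (nonzero) resultant of `GenEllDeFibresPolynomial` over ANY number field
  of presentation (base change to an algebraic closure), hence has finitely many points.

Classical; theorems only, no definitions, no named facts; nothing here bears on [IUTchIII] Cor. 3.12.
-/

noncomputable section

open Polynomial

namespace Literature.NumberTheory.DiophantineGeometry.GenEll

/-! ## Root loci of rational polynomials have finitely many points -/

/-- **The root locus of a nonzero rational polynomial has finitely many points**: if `G ∈ ℚ[X]`,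
`G ≠ 0`, the presented points `P = (F, x)` with `G(x) = 0` have finitely many minimal polynomials (each
is a normalised irreducible factor of `G`). [cite: MochizukiGenEll2010, Ex 1.3 (i) p.5] -/
theorem hasFinitelyManyPoints_aeval_eq_zero (G : ℚ[X]) (hG : G ≠ 0) :
    HasFinitelyManyPoints {P : NFPoint | aeval P.x G = 0} := by
  classical
  refine ((UniqueFactorizationMonoid.normalizedFactors G).toFinset.finite_toSet).subset ?_
  rintro _ ⟨P, hP, rfl⟩
  have hint : IsIntegral ℚ P.x := Algebra.IsIntegral.isIntegral P.x
  have hdvd : NFPoint.mpoly P ∣ G := minpoly.dvd ℚ P.x hP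
  have hirr : Irreducible (NFPoint.mpoly P) := minpoly.irreducible hint
  obtain ⟨r, hr, hassoc⟩ :=
    UniqueFactorizationMonoid.exists_mem_normalizedFactors_of_dvd hG hirr hdvd
  have hnorm : normalize (NFPoint.mpoly P) = NFPoint.mpoly P :=
    (minpoly.monic hint).normalize_eq_self
  have hr' : NFPoint.mpoly P = r := by
    rw [← hnorm, ← UniqueFactorizationMonoid.normalize_normalized_factor r hr]
    exact normalize_eq_normalize hassoc.dvd hassoc.symm.dvd
  simp only [Multiset.mem_toFinset, Finset.mem_coe]
  rw [hr']
  exact hr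

/-- A set of points all of whose coordinates are roots of one nonzero `G ∈ ℚ[X]` has finitely many
points. [cite: MochizukiGenEll2010, Ex 1.3 (i) p.5] -/
theorem hasFinitelyManyPoints_of_aeval_eq_zero {S : Set NFPoint} (G : ℚ[X]) (hG : G ≠ 0)
    (hS : ∀ P ∈ S, aeval P.x G = 0) : HasFinitelyManyPoints S :=
  (hasFinitelyManyPoints_aeval_eq_zero G hG).mono hS

/-- **A prescribed rational coordinate**: the points `P = (F, x)` with `x = q` (`q ∈ ℚ`) have finitely
many points (one minimal polynomial, `X − q`). [cite: MochizukiGenEll2010, Ex 1.3 (i) p.5] -/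
theorem hasFinitelyManyPoints_x_eq_algebraMap (q : ℚ) :
    HasFinitelyManyPoints {P : NFPoint | P.x = algebraMap ℚ P.F q} := by
  refine hasFinitelyManyPoints_of_aeval_eq_zero (X - C q) (X_sub_C_ne_zero q) ?_
  intro P hP
  simp only [Set.mem_setOf_eq] at hP
  simp [hP]

/-- The pole fibre `x = 1/2` of the functions `t_c` on `D_e` (where `1 − 2x = 0`): finitely many points.
[cite: MochizukiGenEll2010, Ex 1.3 (i) p.5] -/
theorem hasFinitelyManyPoints_two_mul_x_eq_one :
    HasFinitelyManyPoints {P : NFPoint | 2 * P.x = 1} := by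
  refine hasFinitelyManyPoints_of_aeval_eq_zero (C 2 * X - 1) ?_ ?_
  · intro h
    have := congrArg (fun p : ℚ[X] => p.eval 1) h
    norm_num at this
  · intro P hP
    simp only [Set.mem_setOf_eq] at hP
    simp [hP]

/-- The fibre `1 − 2x = 0` (same set, the form in which the `t_c`-vocabulary states the pole):
finitely many points. [cite: MochizukiGenEll2010, Ex 1.3 (i) p.5] -/
theorem hasFinitelyManyPoints_one_sub_two_mul_x_eq_zero :
    HasFinitelyManyPoints {P : NFPoint | 1 - 2 * P.x = 0} :=
  hasFinitelyManyPoints_two_mul_x_eq_one.mono fun P hP => by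
    simp only [Set.mem_setOf_eq] at hP ⊢
    linear_combination -hP

/-- Coordinates in a prescribed finite set of rationals: finitely many points.
[cite: MochizukiGenEll2010, Ex 1.3 (i) p.5] -/
theorem hasFinitelyManyPoints_x_mem_finset (A : Finset ℚ) :
    HasFinitelyManyPoints {P : NFPoint | ∃ a ∈ A, P.x = algebraMap ℚ P.F a} := by
  classical
  refine hasFinitelyManyPoints_of_aeval_eq_zero (∏ a ∈ A, (X - C a)) ?_ ?_
  · exact Finset.prod_ne_zero_iff.mpr fun a _ => X_sub_C_ne_zero a
  · rintro P ⟨a, ha, hx⟩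
    rw [map_prod]
    exact Finset.prod_eq_zero ha (by simp [hx])

/-! ## Discard forms for the inequality of BD-classes -/

variable {S : Set NFPoint} {d : ℕ} {ε : ℝ}

/-- **Discarding the root locus of a nonzero rational polynomial does not affect the Vojta inequality.**
[cite: MochizukiGenEll2010, Thm 2.1 p.12] -/
theorem vojtaIneq_of_diff_aeval_eq_zero (hε : 0 ≤ 1 + ε) (G : ℚ[X]) (hG : G ≠ 0)
    (h : VojtaIneq (S \ {P : NFPoint | aeval P.x G = 0}) d ε) : VojtaIneq S d ε :=
  vojtaIneq_of_diff hε ((hasFinitelyManyPoints_aeval_eq_zero G hG).mono Set.inter_subset_left) h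

/-- Discarding the pole fibre `x = 1/2` does not affect the Vojta inequality.
[cite: MochizukiGenEll2010, Thm 2.1 p.12] -/
theorem vojtaIneq_of_diff_two_mul_x_eq_one (hε : 0 ≤ 1 + ε)
    (h : VojtaIneq (S \ {P : NFPoint | 2 * P.x = 1}) d ε) : VojtaIneq S d ε :=
  vojtaIneq_of_diff hε (hasFinitelyManyPoints_two_mul_x_eq_one.mono Set.inter_subset_left) h

/-- Discarding the points with coordinate in a finite set of rationals does not affect the Vojta
inequality. [cite: MochizukiGenEll2010, Thm 2.1 p.12] -/
theorem vojtaIneq_of_diff_x_mem_finset (hε : 0 ≤ 1 + ε) (A : Finset ℚ)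
    (h : VojtaIneq (S \ {P : NFPoint | ∃ a ∈ A, P.x = algebraMap ℚ P.F a}) d ε) : VojtaIneq S d ε :=
  vojtaIneq_of_diff hε ((hasFinitelyManyPoints_x_mem_finset A).mono Set.inter_subset_left) h

/-! ## The `t_c`-fibres of `D_e` over a finite set of bad values -/

/-- **The `t_c`-fibre over the roots of `m` lies in the root locus of the resultant**, over ANY field of
characteristic zero (in particular over the number field of presentation of a point): if `x ∈ F`
carries `r ∈ F` with `r^{2k+1} = x(1−x)`, `r ≠ 0`, `1 − 2x ≠ 0` and `m(t_c(x,r)) = 0`,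
`t_c = ((1−2x) + c·r^{k+2})/(r(1−2x))`, then `x` is a root of
`Res_r(r^{2k+1} − x(1−x), G_m) ∈ ℚ[X]` (`GenEllDeFibresPolynomial`; base change to an algebraic closure,
where the root set of the resultant IS the fibre). [cite: MochizukiGenEll2010, Thm 2.1 p.12] -/
theorem aeval_resultant_eq_zero_of_tC_fibre (k : ℕ) {c : ℚ} (hc : c ≠ 0) {m : ℚ[X]} (hm : m ≠ 0)
    {F : Type*} [Field F] [CharZero F] {x r : F}
    (hcurve : r ^ (2 * k + 1) = x * (1 - x)) (hr : r ≠ 0) (hs : 1 - 2 * x ≠ 0)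
    (ht : aeval (((1 - 2 * x) + algebraMap ℚ F c * r ^ (k + 2)) / (r * (1 - 2 * x))) m = 0) :
    aeval x (resultant (De.curvePoly k) (De.homFibrePolyC k c m)) = 0 := by
  set Ω := AlgebraicClosure F
  have hinj : Function.Injective (algebraMap F Ω) := (algebraMap F Ω).injective
  -- transport the fibre conditions to the algebraic closure
  set x' : Ω := algebraMap F Ω x with hx'
  set r' : Ω := algebraMap F Ω r with hr'
  have hcurve' : r' ^ (2 * k + 1) = x' * (1 - x') := by
    simp only [hx', hr', ← map_pow, hcurve, map_mul, map_sub, map_one]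
  have hr0' : r' ≠ 0 := by
    simp only [hr', ne_eq, map_eq_zero_iff _ hinj]; exact hr
  have hs' : 1 - 2 * x' ≠ 0 := by
    have : algebraMap F Ω (1 - 2 * x) ≠ 0 := by
      rw [ne_eq, map_eq_zero_iff _ hinj]; exact hs
    simpa [hx', map_sub, map_mul, map_ofNat] using this
  have ht' : aeval (((1 - 2 * x') + algebraMap ℚ Ω c * r' ^ (k + 2)) / (r' * (1 - 2 * x'))) m = 0 := by
    have key : ((1 - 2 * x') + algebraMap ℚ Ω c * r' ^ (k + 2)) / (r' * (1 - 2 * x')) =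
        algebraMap F Ω (((1 - 2 * x) + algebraMap ℚ F c * r ^ (k + 2)) / (r * (1 - 2 * x))) := by
      simp only [hx', hr', map_div₀, map_add, map_sub, map_mul, map_pow, map_one, map_ofNat,
        ← IsScalarTower.algebraMap_apply]
    rw [key, aeval_algebraMap_apply, ht, map_zero]
  -- in the algebraic closure the root set of the resultant is exactly the fibre
  have hmem : x' ∈ (resultant (De.curvePoly k) (De.homFibrePolyC k c m)).rootSet Ω := by
    rw [De.rootSet_resultant_homFibrePolyC k hc hm]
    exact ⟨r', hcurve', hr0', hs', ht'⟩
  have h0 := (mem_rootSet.mp hmem).2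
  rw [hx', aeval_algebraMap_apply, map_eq_zero_iff _ hinj] at h0
  exact h0

/-- **The `t_c`-fibre over the roots of a nonzero `m ∈ ℚ[X]` has finitely many points** (`c ≠ 0`): the
presented points `P = (F, x)` carrying `r ∈ F` with `r^{2k+1} = x(1−x)`, `r ≠ 0`, `1 − 2x ≠ 0`,
`m(t_c(x,r)) = 0` have finitely many minimal polynomials — all divide the nonzero resultant.
[cite: MochizukiGenEll2010, Ex 1.3 (i) p.5] -/
theorem hasFinitelyManyPoints_tC_fibre (k : ℕ) {c : ℚ} (hc : c ≠ 0) {m : ℚ[X]} (hm : m ≠ 0) :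
    HasFinitelyManyPoints {P : NFPoint | ∃ r : P.F, r ^ (2 * k + 1) = P.x * (1 - P.x) ∧ r ≠ 0 ∧
      1 - 2 * P.x ≠ 0 ∧
      aeval (((1 - 2 * P.x) + algebraMap ℚ P.F c * r ^ (k + 2)) / (r * (1 - 2 * P.x))) m = 0} := by
  refine hasFinitelyManyPoints_of_aeval_eq_zero _ (De.resultant_homFibrePolyC_ne_zero k c hm) ?_
  rintro P ⟨r, hcurve, hr, hs, ht⟩
  exact aeval_resultant_eq_zero_of_tC_fibre k hc hm hcurve hr hs ht

/-- Discarding the `t_c`-fibre over the roots of a nonzero `m ∈ ℚ[X]` does not affect the Vojta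
inequality. [cite: MochizukiGenEll2010, Thm 2.1 p.12] -/
theorem vojtaIneq_of_diff_tC_fibre (hε : 0 ≤ 1 + ε) (k : ℕ) {c : ℚ} (hc : c ≠ 0) {m : ℚ[X]}
    (hm : m ≠ 0)
    (h : VojtaIneq (S \ {P : NFPoint | ∃ r : P.F, r ^ (2 * k + 1) = P.x * (1 - P.x) ∧ r ≠ 0 ∧
      1 - 2 * P.x ≠ 0 ∧
      aeval (((1 - 2 * P.x) + algebraMap ℚ P.F c * r ^ (k + 2)) / (r * (1 - 2 * P.x))) m = 0}) d ε) :
    VojtaIneq S d ε :=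
  vojtaIneq_of_diff hε ((hasFinitelyManyPoints_tC_fibre k hc hm).mono Set.inter_subset_left) h

end Literature.NumberTheory.DiophantineGeometry.GenEll

end
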